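import Literature.MathematicalPhysics.QuantumFieldTheory.Balaban1983to89.Node00.CriticalOnFibreTopCore

/-!
# NODE 00 — FLOOR-CARRYING twins of the stub-1 chain's named facts: `Prop8RegSepTopStepR`, `HalvingStepTopR`, `HalvingStepTopCoreR` — the same sentences asked only of
# numerics with `c ≤ ν.M₁` (print's «big block size M₁ … R a big positive integer which will be fixed later»), with `.toR ∕ .of_le ∕ .mono_floor` and module 30's
# iteration∕equivalence re-threaded through the floor (the g10 pattern of `Node00/TorusCoverGaugeTokensR` for the (152)∕(9) tokens, applied to the rest of the chain)

Cell `pub-ymgap` (HUMAN RULINGS D-0062 ∕ D-0088), seat `pub-ymgap-dag-n07-e` g20 (R141 (C) row s3 lineage; DAG node N07 = [B11]; lane owner; declarer of modules 20∕23∕29∕30∕34c∕36c), 2026-08-28.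
`--kind definition --supports stmt-QuantumFields-20541` (K0⁷; count-neutral).  Types the repair half of LOCATED-STUB1-FLOOR (cell bus 2026-08-28 08:50Z).

THE PRINT.  [B11] = T. Bałaban, CMP **102** (1985) 277–309 `[Balaban1985Variational]`: p. 300 (144) the cube class of Sect. F (cubes of size `2M L^jη`, `M = M′R₁M₁`, collars from the
numerics), p. 303 (163) *«B₃e^{−½δ₀R₁M₁} ≤ ½»*, p. 304 Prop. 8; [6] = CMP **99** (1985) `[Balaban1985RegularSpaces]` (1.3)–(1.6) p. 77 *«M is a size of big blocks and R is a big positive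
integer which will be fixed later»*; [I] = CMP **109** (1987) `[Balaban1987RG1]` §1: `M₁` = the layer width of the determining sets.  Print's Proposition 8 is stated for the numerics of
the construction, i.e. for `M₁` (and `R₁M₁`) ABOVE a floor depending on `d, L` and the constants; the tree's `Prop8RegSepTopStep F N Sup B₃ a₀ a₁` (module 20) and its Sect.-F
interfaces `HalvingStepTop` (module 30) ∕ `HalvingStepTopCore` (k0-s1-w3) ask the sentence of EVERY `ν : Stage7Numerics` with `0 < ν.M₁` — stronger than print, and not reachable
from the per-datum suppliers of the S6 head, all of which carry floors `… ≤ ν.M₁` (n07-w4 p610759∕p612069∕p615261, collar p612582; the (152)∕(9) R-tokens `c ≤ ν.M₁`; k0-s1-w3's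
`M_h ≥ Mh₀`).  THIS FILE adds the floor as ONE binder `c ≤ ν.M₁` right after `0 < ν.M₁` — nothing else changes — and re-threads module 30's kernel bookkeeping.

WHAT IS PROVED (sorry-free; THREE definitions (named facts, `Prop`s, never asserted); axioms standard).
* §1 `Prop8RegSepTopStepR F N Sup c B₃ a₀ a₁` + `Prop8RegSepTopStep.toR` (floor-free ⇒ every floor), `Prop8RegSepTopStepR.of_le` (antitone in `a₀ a₁`), `.mono_floor` (monotone in `c`),
  `prop8RegSepTopStepR_zero_iff` (`c = 0` is the floor-free fact).
* §2 `HalvingStepTopR` + `.toR ∕ .of_le ∕ .mono_floor`, `halvingStepTopR_zero_iff`; §3 `HalvingStepTopCoreR` + `.toR ∕ .of_le ∕ .mono_floor`, ★ `halvingStepTopCoreR_of_halvingStepTopR`.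
* §4 ★ `classTop_iterate_of_halvingStepTopR`, ★★ `prop8RegSepTopStepR_of_halvingStepTopR` («we continue this way until we reach B₃ε₁» WITH the floor), ★ `halvingStepTopR_of_prop8RegSepTopStepR`,
  ★★ `halvingStepTopR_iff_prop8RegSepTopStepR` (`0 < B₃`) — module 30's §2–§4 with `(hc : c ≤ ν.M₁)` threaded; the proofs are the same terms.
NOT HERE (owners named on the bus): the floor-carrying Core ⇒ Top direction (k0-s1-w3's `K0HalvingStepOfCore.halvingStepTop_of_core`), the floor-carrying `LocalLetters16{5,7}TopStepCore`
and their compositions (n07-w4), the 36c composition at the print datum with floor `max c ((44+4ρ₀L)·L)` (this seat, sequel), and the K0 skeleton text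
`Prop8StepCoPAt := ∃ c B₃ a₀ a₁, … Prop8RegSepTopStepR … c …` (plan, V20).
HONEST SCOPE.  Definitions of named facts + binder-threading bookkeeping; nothing of [B11]'s analysis asserted or proved; the floor-free facts are NOT claimed false (for small `ν.M₁`
they are merely unreachable from floor-carrying suppliers and doubted); `stub_prop8StepCoP13` ∕ K0⁷ NOT closed; N07 NOT discharged; counts unmoved (28∕28 · 5∕27); one finite 𝕋⁴
programme at fixed ε — the route closes the conditional finite-𝕋⁴ rung `BalabanLadder.UV` only; nothing continuum ∕ ℝ⁴ ∕ OS ∕ mass gap ∕ Clay.  No `sorry`, no `instance`, no `notation`.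

References: [B11] (144) p.300, (163) p.303, Prop. 8 p.304; [6] (1.3)–(1.9) p.77; [I] §1 pp.255–264; [Balaban1988Convergent] (2.6)–(2.8) pp.255–256, (2.12) p.256.
-/

noncomputable section

namespace Literature.MathematicalPhysics.QuantumFieldTheory.Balaban1983to89.Node00

open scoped Matrix.Norms.L2Operator
open T4Continuum (T4Family)
open B15DeterminingSets

/-- `η_n ≥ 0` on the lattices of record. [cite: Balaban1987RG1, (1.1) p.260 (bookkeeping)] -/
private theorem eta_nonneg'' (P : Params) (n : ℕ) : 0 ≤ P.eta n := by
  unfold Params.eta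
  exact pow_nonneg (inv_nonneg.mpr (Nat.cast_nonneg _)) n

/-- Weakening the threshold of the record's `PlaqSmallOn`. [cite: Balaban1988Convergent, (1.4) p.247 (bookkeeping)] -/
private theorem plaqSmallOn_of_le'' {P : Params} {j : ℕ} {G : Type*} [GaugeGroup G] {S : Set (Plaq P j)} {δ δ' : ℝ} {U : GaugeField P j G}
    (h : PlaqSmallOn S δ U) (hδ : δ ≤ δ') : PlaqSmallOn S δ' U :=
  fun p hp => (h p hp).trans_le hδ

/-- `max{B₃δ, c} ≤ 2·max{B₃δ′, c}` from `δ ≤ 2δ′` (`B₃, c ≥ 0`). [cite: Balaban1985Variational, p.304 before Prop. 8 (bookkeeping)] -/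
private theorem max_le_two_mul_max' {B₃ c d d' : ℝ} (hB₃ : 0 ≤ B₃) (hc : 0 ≤ c) (hd : d ≤ 2 * d') :
    max (B₃ * d) c ≤ 2 * max (B₃ * d') c := by
  refine max_le ?_ ?_
  · calc B₃ * d ≤ B₃ * (2 * d') := mul_le_mul_of_nonneg_left hd hB₃
      _ = 2 * (B₃ * d') := by ring
      _ ≤ 2 * max (B₃ * d') c := mul_le_mul_of_nonneg_left (le_max_left _ _) zero_le_two
  · calc c ≤ 2 * c := le_mul_of_one_le_left hc one_le_two
      _ ≤ 2 * max (B₃ * d') c := mul_le_mul_of_nonneg_left (le_max_right _ _) zero_le_two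

/-! ## §1  `Prop8RegSepTopStepR`: Proposition 8's top step asked only of numerics with `c ≤ ν.M₁` -/

section FactsR

variable (F : T4Family) (N : ℕ) [NeZero N]

/-- **[B11] PROPOSITION 8's TOP STEP, FLOOR-CARRYING**: module 20's `Prop8RegSepTopStep` with ONE more binder `c ≤ ν.M₁` after `0 < ν.M₁` (print's «M₁ large»).
[cite: Balaban1985Variational, Prop. 8 p.304; Balaban1985RegularSpaces, (1.3)–(1.6) p.77] -/
def Prop8RegSepTopStepR (Sup : (ν : Stage7Numerics) → (K : ℕ) → (ℕ → Set (Site (F.P K) 0)) → Set (Site (F.P K) 0)) (c : ℕ) (B₃ a₀ a₁ : ℝ) : Prop :=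
  ∀ (ν : Stage7Numerics) (M : ℕ) (g : ℕ → ℝ) (K k : ℕ) (s : SeqOfRecord F ν M g K k), Sect2.SeqSeparated ν.M₁ s → 0 < ν.M₁ → c ≤ ν.M₁ → 1 ≤ k →
    ∀ (ε₀ : ℝ) (δ : ℕ → ℝ),
    (∀ n, n ≤ k → 0 < δ n ∧ δ n ≤ a₁ ∧ B₃ * δ n ≤ ε₀) → (∀ n, n < k → δ n ≤ 2 * δ (n + 1)) → (∀ n, n < k → δ (n + 1) ≤ 2 * δ n) → ε₀ ≤ a₀ →
    ∀ W : MSField (F.P K) (SU N), Sect2.DataSmall7PTop (avOfRecord F N K) s.Ω (Sup ν K s.Ω) k δ W →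
      ∀ U : GaugeField (F.P K) 0 (SU N),
        (∀ n, n ≤ k → PlaqSmallOn (Sect2.omegaPlaqsTop s.Ω (Sup ν K s.Ω) n) (ε₀ * (F.P K).eta n ^ 2) U) →
        Sect2.CoDivClassOnTop s.Ω (Sup ν K s.Ω) k ε₀ U → AgreeOn (genSet s.Ω k) (avgFamily (avOfRecord F N K) U) W →
        IsCritOnFibre F N K (genSet s.Ω k) W U →
        (∀ n, n ≤ k → PlaqSmallOn (Sect2.omegaPlaqsTop s.Ω (Sup ν K s.Ω) n) (B₃ * δ n * (F.P K).eta n ^ 2) U) ∧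
          ∀ n, n ≤ k → Sect2.CoDivSmallOn (Sect2.omegaBondsTop s.Ω (Sup ν K s.Ω) n) (B₃ * δ n * (F.P K).eta n ^ 3) U

/-- **SECT. F's ONE-STEP IMPROVEMENT, FLOOR-CARRYING**: module 30's `HalvingStepTop` with the binder `c ≤ ν.M₁`. [cite: Balaban1985Variational, Sect. F p.304; Balaban1985RegularSpaces, (1.3)–(1.6) p.77] -/
def HalvingStepTopR (Sup : (ν : Stage7Numerics) → (K : ℕ) → (ℕ → Set (Site (F.P K) 0)) → Set (Site (F.P K) 0)) (c : ℕ) (B₃ a₀ a₁ : ℝ) : Prop :=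
  ∀ (ν : Stage7Numerics) (M : ℕ) (g : ℕ → ℝ) (K k : ℕ) (s : SeqOfRecord F ν M g K k), Sect2.SeqSeparated ν.M₁ s → 0 < ν.M₁ → c ≤ ν.M₁ → 1 ≤ k →
    ∀ (ε δ : ℕ → ℝ),
    (∀ n, n ≤ k → 0 < δ n ∧ δ n ≤ a₁) → (∀ n, n < k → δ n ≤ 2 * δ (n + 1)) → (∀ n, n < k → δ (n + 1) ≤ 2 * δ n) →
    (∀ n, n ≤ k → B₃ * δ n ≤ ε n ∧ ε n ≤ a₀) → (∀ n, n < k → ε n ≤ 2 * ε (n + 1)) → (∀ n, n < k → ε (n + 1) ≤ 2 * ε n) →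
    ∀ W : MSField (F.P K) (SU N), Sect2.DataSmall7PTop (avOfRecord F N K) s.Ω (Sup ν K s.Ω) k δ W →
      ∀ U : GaugeField (F.P K) 0 (SU N),
        (∀ n, n ≤ k → PlaqSmallOn (Sect2.omegaPlaqsTop s.Ω (Sup ν K s.Ω) n) (ε n * (F.P K).eta n ^ 2) U) →
        (∀ n, n ≤ k → Sect2.CoDivSmallOn (Sect2.omegaBondsTop s.Ω (Sup ν K s.Ω) n) (ε n * (F.P K).eta n ^ 3) U) →
        AgreeOn (genSet s.Ω k) (avgFamily (avOfRecord F N K) U) W →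
        IsCritOnFibre F N K (genSet s.Ω k) W U →
        (∀ n, n ≤ k → PlaqSmallOn (Sect2.omegaPlaqsTop s.Ω (Sup ν K s.Ω) n) (max (B₃ * δ n) (ε n / 2) * (F.P K).eta n ^ 2) U) ∧
          ∀ n, n ≤ k → Sect2.CoDivSmallOn (Sect2.omegaBondsTop s.Ω (Sup ν K s.Ω) n) (max (B₃ * δ n) (ε n / 2) * (F.P K).eta n ^ 3) U

/-- **THE CORE FORM, FLOOR-CARRYING**: k0-s1-w3's `HalvingStepTopCore` with the binder `c ≤ ν.M₁`. [cite: Balaban1985Variational, Sect. F p.304; Balaban1985RegularSpaces, (1.3)–(1.6) p.77] -/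
def HalvingStepTopCoreR (Sup : (ν : Stage7Numerics) → (K : ℕ) → (ℕ → Set (Site (F.P K) 0)) → Set (Site (F.P K) 0)) (c : ℕ) (B₃ a₀ a₁ : ℝ) : Prop :=
  ∀ (ν : Stage7Numerics) (M : ℕ) (g : ℕ → ℝ) (K k : ℕ) (s : SeqOfRecord F ν M g K k), Sect2.SeqSeparated ν.M₁ s → 0 < ν.M₁ → c ≤ ν.M₁ → 1 ≤ k →
    ∀ (ε δ : ℕ → ℝ),
    (∀ n, n ≤ k → 0 < δ n ∧ δ n ≤ a₁) → (∀ n, n < k → δ n ≤ 2 * δ (n + 1)) → (∀ n, n < k → δ (n + 1) ≤ 2 * δ n) →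
    (∀ n, n ≤ k → B₃ * δ n ≤ ε n ∧ ε n ≤ a₀) → (∀ n, n < k → ε n ≤ 2 * ε (n + 1)) → (∀ n, n < k → ε (n + 1) ≤ 2 * ε n) →
    ∀ W : MSField (F.P K) (SU N), Sect2.DataSmall7PTop (avOfRecord F N K) s.Ω (Sup ν K s.Ω) k δ W →
      ∀ U : GaugeField (F.P K) 0 (SU N),
        (∀ n, n ≤ k → PlaqSmallOn (Sect2.omegaPlaqsTop s.Ω (Sup ν K s.Ω) n) (ε n * (F.P K).eta n ^ 2) U) →
        (∀ n, n ≤ k → Sect2.CoDivSmallOn (Sect2.omegaBondsTop s.Ω (Sup ν K s.Ω) n) (ε n * (F.P K).eta n ^ 3) U) →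
        AgreeOn (genSet s.Ω k) (avgFamily (avOfRecord F N K) U) W →
        IsCritOnFibre F N K (genSet s.Ω k) W U →
        (∀ n, n ≤ k → ∀ p ∈ Sect2.omegaPlaqsTop s.Ω (Sup ν K s.Ω) n, p ∉ Sect2.printedPlaqs s.Ω k 0 →
            dist1 (GaugeField.plaqHol U p) < max (B₃ * δ n) (ε n / 2) * (F.P K).eta n ^ 2) ∧
          ∀ n, n ≤ k → ∀ b ∈ Sect2.omegaBondsTop s.Ω (Sup ν K s.Ω) n, b ∉ Sect2.bondsDeep (s.Ω 1)ᶜ →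
            ‖Sect2.coDivSum U b.src b.dir‖ < max (B₃ * δ n) (ε n / 2) * (F.P K).eta n ^ 3

variable {F N}

/-- Floor-free ⇒ floor-carrying, every floor (the floor only weakens). [cite: Balaban1985Variational, Prop. 8 p.304 (bookkeeping)] -/
theorem Prop8RegSepTopStep.toR {Sup : (ν : Stage7Numerics) → (K : ℕ) → (ℕ → Set (Site (F.P K) 0)) → Set (Site (F.P K) 0)} {B₃ a₀ a₁ : ℝ}
    (h : Prop8RegSepTopStep F N Sup B₃ a₀ a₁) (c : ℕ) : Prop8RegSepTopStepR F N Sup c B₃ a₀ a₁ :=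
  fun ν M g K k s hsep hM₁ _ hk => h ν M g K k s hsep hM₁ hk

/-- Antitone in the ceilings. [cite: Balaban1985Variational, Prop. 8 p.304 (bookkeeping)] -/
theorem Prop8RegSepTopStepR.of_le {Sup : (ν : Stage7Numerics) → (K : ℕ) → (ℕ → Set (Site (F.P K) 0)) → Set (Site (F.P K) 0)} {c : ℕ} {B₃ a₀ a₀' a₁ a₁' : ℝ}
    (h : Prop8RegSepTopStepR F N Sup c B₃ a₀ a₁) (ha₀ : a₀' ≤ a₀) (ha₁ : a₁' ≤ a₁) : Prop8RegSepTopStepR F N Sup c B₃ a₀' a₁' :=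
  fun ν M g K k s hsep hM₁ hc hk ε₀ δ hδ hcomp hcomp' hε₀ W h7 U h17 h19 hfib hcrit =>
    h ν M g K k s hsep hM₁ hc hk ε₀ δ (fun n hn => ⟨(hδ n hn).1, (hδ n hn).2.1.trans ha₁, (hδ n hn).2.2⟩) hcomp hcomp' (hε₀.trans ha₀) W h7 U h17 h19 hfib hcrit

/-- Monotone in the floor. [cite: Balaban1985RegularSpaces, (1.3)–(1.6) p.77 (bookkeeping)] -/
theorem Prop8RegSepTopStepR.mono_floor {Sup : (ν : Stage7Numerics) → (K : ℕ) → (ℕ → Set (Site (F.P K) 0)) → Set (Site (F.P K) 0)} {c c' : ℕ} {B₃ a₀ a₁ : ℝ}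
    (h : Prop8RegSepTopStepR F N Sup c B₃ a₀ a₁) (hcc : c ≤ c') : Prop8RegSepTopStepR F N Sup c' B₃ a₀ a₁ :=
  fun ν M g K k s hsep hM₁ hc' hk => h ν M g K k s hsep hM₁ (hcc.trans hc') hk

/-- At floor `0` the floor-carrying fact IS the floor-free one. [cite: Balaban1985Variational, Prop. 8 p.304 (bookkeeping)] -/
theorem prop8RegSepTopStepR_zero_iff {Sup : (ν : Stage7Numerics) → (K : ℕ) → (ℕ → Set (Site (F.P K) 0)) → Set (Site (F.P K) 0)} {B₃ a₀ a₁ : ℝ} :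
    Prop8RegSepTopStepR F N Sup 0 B₃ a₀ a₁ ↔ Prop8RegSepTopStep F N Sup B₃ a₀ a₁ :=
  ⟨fun h ν M g K k s hsep hM₁ hk => h ν M g K k s hsep hM₁ (Nat.zero_le _) hk, fun h => h.toR 0⟩

/-- Floor-free ⇒ floor-carrying (one step). [cite: Balaban1985Variational, Sect. F p.304 (bookkeeping)] -/
theorem HalvingStepTop.toR {Sup : (ν : Stage7Numerics) → (K : ℕ) → (ℕ → Set (Site (F.P K) 0)) → Set (Site (F.P K) 0)} {B₃ a₀ a₁ : ℝ}
    (h : HalvingStepTop F N Sup B₃ a₀ a₁) (c : ℕ) : HalvingStepTopR F N Sup c B₃ a₀ a₁ :=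
  fun ν M g K k s hsep hM₁ _ hk => h ν M g K k s hsep hM₁ hk

/-- Antitone in the ceilings (one step). [cite: Balaban1985Variational, Sect. F p.304 (bookkeeping)] -/
theorem HalvingStepTopR.of_le {Sup : (ν : Stage7Numerics) → (K : ℕ) → (ℕ → Set (Site (F.P K) 0)) → Set (Site (F.P K) 0)} {c : ℕ} {B₃ a₀ a₀' a₁ a₁' : ℝ}
    (h : HalvingStepTopR F N Sup c B₃ a₀ a₁) (ha₀ : a₀' ≤ a₀) (ha₁ : a₁' ≤ a₁) : HalvingStepTopR F N Sup c B₃ a₀' a₁' :=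
  fun ν M g K k s hsep hM₁ hc hk ε δ hδ hcomp hcomp' hε hεcomp hεcomp' W h7 U h17 h19 hfib hcrit =>
    h ν M g K k s hsep hM₁ hc hk ε δ (fun n hn => ⟨(hδ n hn).1, (hδ n hn).2.trans ha₁⟩) hcomp hcomp'
      (fun n hn => ⟨(hε n hn).1, (hε n hn).2.trans ha₀⟩) hεcomp hεcomp' W h7 U h17 h19 hfib hcrit

/-- Monotone in the floor (one step). [cite: Balaban1985RegularSpaces, (1.3)–(1.6) p.77 (bookkeeping)] -/
theorem HalvingStepTopR.mono_floor {Sup : (ν : Stage7Numerics) → (K : ℕ) → (ℕ → Set (Site (F.P K) 0)) → Set (Site (F.P K) 0)} {c c' : ℕ} {B₃ a₀ a₁ : ℝ}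
    (h : HalvingStepTopR F N Sup c B₃ a₀ a₁) (hcc : c ≤ c') : HalvingStepTopR F N Sup c' B₃ a₀ a₁ :=
  fun ν M g K k s hsep hM₁ hc' hk => h ν M g K k s hsep hM₁ (hcc.trans hc') hk

/-- At floor `0` the floor-carrying one-step fact IS the floor-free one. [cite: Balaban1985Variational, Sect. F p.304 (bookkeeping)] -/
theorem halvingStepTopR_zero_iff {Sup : (ν : Stage7Numerics) → (K : ℕ) → (ℕ → Set (Site (F.P K) 0)) → Set (Site (F.P K) 0)} {B₃ a₀ a₁ : ℝ} :
    HalvingStepTopR F N Sup 0 B₃ a₀ a₁ ↔ HalvingStepTop F N Sup B₃ a₀ a₁ :=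
  ⟨fun h ν M g K k s hsep hM₁ hk => h ν M g K k s hsep hM₁ (Nat.zero_le _) hk, fun h => h.toR 0⟩

/-- Floor-free ⇒ floor-carrying (core form). [cite: Balaban1985Variational, Sect. F p.304 (bookkeeping)] -/
theorem HalvingStepTopCore.toR {Sup : (ν : Stage7Numerics) → (K : ℕ) → (ℕ → Set (Site (F.P K) 0)) → Set (Site (F.P K) 0)} {B₃ a₀ a₁ : ℝ}
    (h : HalvingStepTopCore F N Sup B₃ a₀ a₁) (c : ℕ) : HalvingStepTopCoreR F N Sup c B₃ a₀ a₁ :=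
  fun ν M g K k s hsep hM₁ _ hk => h ν M g K k s hsep hM₁ hk

/-- Antitone in the ceilings (core form). [cite: Balaban1985Variational, Sect. F p.304 (bookkeeping)] -/
theorem HalvingStepTopCoreR.of_le {Sup : (ν : Stage7Numerics) → (K : ℕ) → (ℕ → Set (Site (F.P K) 0)) → Set (Site (F.P K) 0)} {c : ℕ} {B₃ a₀ a₀' a₁ a₁' : ℝ}
    (h : HalvingStepTopCoreR F N Sup c B₃ a₀ a₁) (ha₀ : a₀' ≤ a₀) (ha₁ : a₁' ≤ a₁) : HalvingStepTopCoreR F N Sup c B₃ a₀' a₁' :=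
  fun ν M g K k s hsep hM₁ hc hk ε δ hδ hcomp hcomp' hε hεcomp hεcomp' W h7 U h17 h19 hfib hcrit =>
    h ν M g K k s hsep hM₁ hc hk ε δ (fun n hn => ⟨(hδ n hn).1, (hδ n hn).2.trans ha₁⟩) hcomp hcomp'
      (fun n hn => ⟨(hε n hn).1, (hε n hn).2.trans ha₀⟩) hεcomp hεcomp' W h7 U h17 h19 hfib hcrit

/-- Monotone in the floor (core form). [cite: Balaban1985RegularSpaces, (1.3)–(1.6) p.77 (bookkeeping)] -/
theorem HalvingStepTopCoreR.mono_floor {Sup : (ν : Stage7Numerics) → (K : ℕ) → (ℕ → Set (Site (F.P K) 0)) → Set (Site (F.P K) 0)} {c c' : ℕ} {B₃ a₀ a₁ : ℝ}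
    (h : HalvingStepTopCoreR F N Sup c B₃ a₀ a₁) (hcc : c ≤ c') : HalvingStepTopCoreR F N Sup c' B₃ a₀ a₁ :=
  fun ν M g K k s hsep hM₁ hc' hk => h ν M g K k s hsep hM₁ (hcc.trans hc') hk

/-- ★ RESTRICTION with the floor: the full one-step fact implies its core form (forget the pure-data conclusions), floor unchanged. [cite: Balaban1985Variational, Sect. F p.304 (bookkeeping)] -/
theorem halvingStepTopCoreR_of_halvingStepTopR {Sup : (ν : Stage7Numerics) → (K : ℕ) → (ℕ → Set (Site (F.P K) 0)) → Set (Site (F.P K) 0)}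
    {c : ℕ} {B₃ a₀ a₁ : ℝ} (h : HalvingStepTopR F N Sup c B₃ a₀ a₁) : HalvingStepTopCoreR F N Sup c B₃ a₀ a₁ := by
  intro ν M g K k s hsep hM₁ hc hk ε δ hδ hcomp hcomp' hε hεcomp hεcomp' W h7 U h17 h19 hfib hcrit
  obtain ⟨hP, hD⟩ := h ν M g K k s hsep hM₁ hc hk ε δ hδ hcomp hcomp' hε hεcomp hεcomp' W h7 U h17 h19 hfib hcrit
  exact ⟨fun n hn p hp _ => hP n hn p hp, fun n hn b hb _ => hD n hn b hb⟩

end FactsR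

/-! ## §4  Module 30's iteration and equivalence WITH the floor -/

section IterationR

variable {F : T4Family} {N : ℕ} [NeZero N]

/-- ★ «We continue this way», floor-carrying: module 30's `classTop_iterate_of_halvingStepTop` with `(hc : c ≤ ν.M₁)` threaded. [cite: Balaban1985Variational, p.304 before Prop. 8] -/
theorem classTop_iterate_of_halvingStepTopR {Sup : (ν : Stage7Numerics) → (K : ℕ) → (ℕ → Set (Site (F.P K) 0)) → Set (Site (F.P K) 0)}
    {B₃ a₀ a₁ : ℝ} (hB₃ : 0 ≤ B₃) {c : ℕ} (h : HalvingStepTopR F N Sup c B₃ a₀ a₁) (ν : Stage7Numerics) (M : ℕ) (g : ℕ → ℝ) (K k : ℕ)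
    (s : SeqOfRecord F ν M g K k) (hsep : Sect2.SeqSeparated ν.M₁ s) (hM₁ : 0 < ν.M₁) (hc' : c ≤ ν.M₁) (hk : 1 ≤ k) (ε₀ : ℝ) (δ : ℕ → ℝ)
    (hδ : ∀ n, n ≤ k → 0 < δ n ∧ δ n ≤ a₁ ∧ B₃ * δ n ≤ ε₀) (hcomp : ∀ n, n < k → δ n ≤ 2 * δ (n + 1))
    (hcomp' : ∀ n, n < k → δ (n + 1) ≤ 2 * δ n) (hε₀ : ε₀ ≤ a₀) (W : MSField (F.P K) (SU N))
    (h7 : Sect2.DataSmall7PTop (avOfRecord F N K) s.Ω (Sup ν K s.Ω) k δ W) (U : GaugeField (F.P K) 0 (SU N))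
    (h17 : ∀ n, n ≤ k → PlaqSmallOn (Sect2.omegaPlaqsTop s.Ω (Sup ν K s.Ω) n) (ε₀ * (F.P K).eta n ^ 2) U)
    (h19 : Sect2.CoDivClassOnTop s.Ω (Sup ν K s.Ω) k ε₀ U) (hfib : AgreeOn (genSet s.Ω k) (avgFamily (avOfRecord F N K) U) W)
    (hcrit : IsCritOnFibre F N K (genSet s.Ω k) W U) (m : ℕ) :
    (∀ n, n ≤ k → PlaqSmallOn (Sect2.omegaPlaqsTop s.Ω (Sup ν K s.Ω) n) (max (B₃ * δ n) (ε₀ / 2 ^ m) * (F.P K).eta n ^ 2) U) ∧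
      ∀ n, n ≤ k → Sect2.CoDivSmallOn (Sect2.omegaBondsTop s.Ω (Sup ν K s.Ω) n) (max (B₃ * δ n) (ε₀ / 2 ^ m) * (F.P K).eta n ^ 3) U := by
  have hη : ∀ n, 0 ≤ (F.P K).eta n := eta_nonneg'' (F.P K)
  -- `0 ≤ B₃δ_0 ≤ ε₀`: the starting radius is non-negative
  have hε₀nn : 0 ≤ ε₀ := (mul_nonneg hB₃ (hδ 0 (Nat.zero_le _)).1.le).trans (hδ 0 (Nat.zero_le _)).2.2
  induction m with
  | zero =>
    -- the weakening `ε₀ ≤ max{B₃δ_n, ε₀}`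
    have hle : ∀ n, ε₀ ≤ max (B₃ * δ n) (ε₀ / 2 ^ 0) := fun n => by
      rw [pow_zero, div_one]
      exact le_max_right _ _
    exact ⟨fun n hn => plaqSmallOn_of_le'' (h17 n hn) (mul_le_mul_of_nonneg_right (hle n) (pow_nonneg (hη n) 2)),
      fun n hn => (h19 n hn).of_le (mul_le_mul_of_nonneg_right (hle n) (pow_nonneg (hη n) 3))⟩
  | succ m ih =>
    -- «we apply again the whole reasoning with ½ε₀ instead of ε₀», at the radii `ε_n := max{B₃δ_n, ε₀/2^m}`
    have hc : 0 ≤ ε₀ / 2 ^ m := div_nonneg hε₀nn (pow_nonneg zero_le_two m)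
    have hεblk : ∀ n, n ≤ k → B₃ * δ n ≤ max (B₃ * δ n) (ε₀ / 2 ^ m) ∧ max (B₃ * δ n) (ε₀ / 2 ^ m) ≤ a₀ := fun n hn =>
      ⟨le_max_left _ _, (B11Prop8Assembly.stage_le (hδ n hn).2.2 hε₀nn m).trans hε₀⟩
    have hεcomp : ∀ n, n < k → max (B₃ * δ n) (ε₀ / 2 ^ m) ≤ 2 * max (B₃ * δ (n + 1)) (ε₀ / 2 ^ m) := fun n hn =>
      max_le_two_mul_max' hB₃ hc (hcomp n hn)
    have hεcomp' : ∀ n, n < k → max (B₃ * δ (n + 1)) (ε₀ / 2 ^ m) ≤ 2 * max (B₃ * δ n) (ε₀ / 2 ^ m) := fun n hn =>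
      max_le_two_mul_max' hB₃ hc (hcomp' n hn)
    obtain ⟨hP, hD⟩ := h ν M g K k s hsep hM₁ hc' hk (fun n => max (B₃ * δ n) (ε₀ / 2 ^ m)) δ (fun n hn => ⟨(hδ n hn).1, (hδ n hn).2.1⟩) hcomp
      hcomp' hεblk hεcomp hεcomp' W h7 U ih.1 ih.2 hfib hcrit
    -- the output radius `max{B₃δ_n, ½·max{B₃δ_n, ε₀/2^m}} ≤ max{B₃δ_n, ε₀/2^{m+1}}`
    have hhalf : ∀ n, n ≤ k → max (B₃ * δ n) (max (B₃ * δ n) (ε₀ / 2 ^ m) / 2) ≤ max (B₃ * δ n) (ε₀ / 2 ^ (m + 1)) := fun n hn =>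
      B11Prop8Assembly.max_half_le (mul_nonneg hB₃ (hδ n hn).1.le) m
    exact ⟨fun n hn => plaqSmallOn_of_le'' (hP n hn) (mul_le_mul_of_nonneg_right (hhalf n hn) (pow_nonneg (hη n) 2)),
      fun n hn => (hD n hn).of_le (mul_le_mul_of_nonneg_right (hhalf n hn) (pow_nonneg (hη n) 3))⟩

end IterationR

section Prop8FromHalvingR

variable {F : T4Family} {N : ℕ} [NeZero N]

/-- ★★ **PROPOSITION 8's TOP STEP FROM SECT. F's ONE-STEP IMPROVEMENT, WITH THE FLOOR** («until we reach the bound B₃ε₁»): `HalvingStepTopR c ⇒ Prop8RegSepTopStepR c` (`0 < B₃`), same constants.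
[cite: Balaban1985Variational, Prop. 8 p.304, Sect. F pp.300–304] -/
theorem prop8RegSepTopStepR_of_halvingStepTopR {Sup : (ν : Stage7Numerics) → (K : ℕ) → (ℕ → Set (Site (F.P K) 0)) → Set (Site (F.P K) 0)}
    {B₃ a₀ a₁ : ℝ} (hB₃ : 0 < B₃) {c : ℕ} (h : HalvingStepTopR F N Sup c B₃ a₀ a₁) : Prop8RegSepTopStepR F N Sup c B₃ a₀ a₁ := by
  intro ν M g K k s hsep hM₁ hc' hk ε₀ δ hδ hcomp hcomp' hε₀ W h7 U h17 h19 hfib hcrit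
  have hit := classTop_iterate_of_halvingStepTopR hB₃.le h ν M g K k s hsep hM₁ hc' hk ε₀ δ hδ hcomp hcomp' hε₀ W h7 U h17 h19 hfib hcrit
  refine ⟨fun n hn => ?_, fun n hn => ?_⟩
  · obtain ⟨m, hm⟩ := B11.halving_reaches_B3eps1 ε₀ (B₃ * δ n) (mul_pos hB₃ (hδ n hn).1)
    have hP := (hit m).1 n hn
    rwa [hm] at hP
  · obtain ⟨m, hm⟩ := B11.halving_reaches_B3eps1 ε₀ (B₃ * δ n) (mul_pos hB₃ (hδ n hn).1)
    have hD := (hit m).2 n hn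
    rwa [hm] at hD


/-- ★ The converse with the floor: `Prop8RegSepTopStepR c ⇒ HalvingStepTopR c` (one application at the scalar radius `a₀`). [cite: Balaban1985Variational, Prop. 8 p.304 (bookkeeping)] -/
theorem halvingStepTopR_of_prop8RegSepTopStepR {Sup : (ν : Stage7Numerics) → (K : ℕ) → (ℕ → Set (Site (F.P K) 0)) → Set (Site (F.P K) 0)}
    {B₃ a₀ a₁ : ℝ} {c : ℕ} (h : Prop8RegSepTopStepR F N Sup c B₃ a₀ a₁) : HalvingStepTopR F N Sup c B₃ a₀ a₁ := by
  intro ν M g K k s hsep hM₁ hc' hk ε δ hδ hcomp hcomp' hε _hεcomp _hεcomp' W h7 U h17 h19 hfib hcrit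
  have hη : ∀ n, 0 ≤ (F.P K).eta n := eta_nonneg'' (F.P K)
  -- the class at radii `ε_n ≤ a₀` lies in the class at the scalar radius `a₀`
  have h17' : ∀ n, n ≤ k → PlaqSmallOn (Sect2.omegaPlaqsTop s.Ω (Sup ν K s.Ω) n) (a₀ * (F.P K).eta n ^ 2) U := fun n hn =>
    plaqSmallOn_of_le'' (h17 n hn) (mul_le_mul_of_nonneg_right (hε n hn).2 (pow_nonneg (hη n) 2))
  have h19' : Sect2.CoDivClassOnTop s.Ω (Sup ν K s.Ω) k a₀ U := fun n hn =>
    (h19 n hn).of_le (mul_le_mul_of_nonneg_right (hε n hn).2 (pow_nonneg (hη n) 3))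
  obtain ⟨hP, hD⟩ := h ν M g K k s hsep hM₁ hc' hk a₀ δ (fun n hn => ⟨(hδ n hn).1, (hδ n hn).2, (hε n hn).1.trans (hε n hn).2⟩)
    hcomp hcomp' le_rfl W h7 U h17' h19' hfib hcrit
  exact ⟨fun n hn => plaqSmallOn_of_le'' (hP n hn) (mul_le_mul_of_nonneg_right (le_max_left _ _) (pow_nonneg (hη n) 2)),
    fun n hn => (hD n hn).of_le (mul_le_mul_of_nonneg_right (le_max_left _ _) (pow_nonneg (hη n) 3))⟩


/-- ★★ **EQUIVALENCE WITH THE FLOOR** (`0 < B₃`): `HalvingStepTopR c ⟺ Prop8RegSepTopStepR c`. [cite: Balaban1985Variational, Prop. 8 p.304, Sect. F pp.300–304 (bookkeeping)] -/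
theorem halvingStepTopR_iff_prop8RegSepTopStepR {Sup : (ν : Stage7Numerics) → (K : ℕ) → (ℕ → Set (Site (F.P K) 0)) → Set (Site (F.P K) 0)}
    {c : ℕ} {B₃ a₀ a₁ : ℝ} (hB₃ : 0 < B₃) : HalvingStepTopR F N Sup c B₃ a₀ a₁ ↔ Prop8RegSepTopStepR F N Sup c B₃ a₀ a₁ :=
  ⟨prop8RegSepTopStepR_of_halvingStepTopR hB₃, halvingStepTopR_of_prop8RegSepTopStepR⟩

end Prop8FromHalvingR

end Literature.MathematicalPhysics.QuantumFieldTheory.Balaban1983to89.Node00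

end
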